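/-
Copyright: lit-balaban cell (HOME `run/shared/lean/pub/lit-balaban/`), Phase-2 proof seat p12 (gen 10).  The proofs are
kernel-checked; nothing is claimed beyond what the kernel checks below.
-/
import Literature.MathematicalPhysics.QuantumFieldTheory.DybalskiStottmeisterTanimoto2024.DST24LaplacianBounds

/-!
# `DybalskiStottmeisterTanimoto2024.DST24FinitePropagation` — the `𝓛² → 𝓛^∞` transfer behind [DybalskiStottmeisterTanimoto2024]
# §4.5 Lemma (infty-bounds): **an a-priori sup-norm bound, uniform in the volume `n`, for the solutions of `Mu = f` when `M`
# is coercive and bounded on `𝓛²(Ω)` and of finite range** (Richardson/Neumann iteration + finite propagation speed)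

statement-level skeleton of published theorems with citation tags; proofs where landed; nothing here is a claim about
the Yang–Mills mass gap

W. Dybalski, A. Stottmeister, Y. Tanimoto, *The Bałaban variational problem in the non-linear sigma model*, Rev. Math. Phys.
**36** (2024), arXiv:2403.09800; source held `paper:arxiv-2403.09800` (§4.5 «`𝓛^∞`-bounds on `Γ`, `(QΓQ*)⁻¹`, `(QΓR*Q*)⁻¹`» =
tex chunk p0015; §4.3 «Exponential decay of integral kernels», §4.4 «Method of images» = p0013–p0015).  Unit `lit-balaban-p12`
(gen 10), free-target protocol G.5-34(d) in the seat's own lane (the DST24 directory, p12 gens 5/7).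

WHY THIS FILE (the road taken, stated once).  The paper obtains Lemma (infty-bounds) «`‖Γ‖_{∞,∞;Ω} ≤ C`, `‖(QΓQ*)⁻¹‖_{∞,∞;Ω₁} ≤ C`
for `C` independent of `n`» from the exponential decay of the kernels of `G(Ω)` and `(QG(Ω)Q*)⁻¹` (Lemma (Green-function-Neumann)),
itself imported from the infinite-lattice random-walk expansion of [DST23] (§4.3, Appendix A) through the method of images (§4.4),
and the row-sum estimate (norm-estimate) «`‖M‖_{∞,∞;Ω} ≤ sup_x Σ_{x′} ‖M(x,x′)‖`».  The tree already holds the two `𝓛²` inputs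
of §4.2 with explicit constants — (many-boxes) `⟨f,f⟩ ≤ 8L⁴⟨f,(−Δ_Ω + Q*Q)f⟩` (`DST24GreenFunction.many_boxes`) and (bounded-Laplacian)
`‖(−Δ_Ω + Q*Q)f‖² ≤ 130‖f‖²` (`DST24LaplacianBounds.ipS_Mfun_Mfun_le`) — and from these the volume-uniform `𝓛^∞` bound follows by a
SHORTER ROAD which this file formalizes once, for an arbitrary linear `M` on `𝓛²(Ω; E)`:
if `σ⟨f,f⟩ ≤ ⟨f,Mf⟩`, `⟨Mf,Mf⟩ ≤ Λ₂⟨f,f⟩` and `(Mf)(x)` depends only on `f` in the blocks at block-distance `≤ ρ` from the block of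
`x`, then every solution of `Mu = f` obeys `‖u‖_{∞;Ω} ≤ (4L(2ρ+1)Λ₂/σ³)·‖f‖_{∞;Ω}` (`norm_le_of_apply_eq`).  Mechanism: with
`c = σ/Λ₂` the Richardson step `T = 1 − cM` contracts `𝓛²`, `‖Tg‖² ≤ (1 − σ²/Λ₂)‖g‖²` (`ipS_step_le`), `u = Σ_{k<K} cT^kf + T^Ku`
exactly (`telescope`), `T^k` has range `kρ` (finite propagation, `HasRange.pow`), so `(T^kf)(x)` only sees `f` on `≤ L²(2kρ+1)²` sites
(`card_ball_le`) and `|(T^kf)(x)| ≤ θ^k·L(2kρ+1)‖f‖_∞` with `θ² = 1 − σ²/Λ₂ < 1`; summing the series (`sum_succ_mul_pow_le`) and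
letting `K → ∞` gives the bound with no reference to the volume.  This replaces kernels, exponential weights and images; the
printed STATEMENT of Lemma (infty-bounds) is then proved verbatim in `DST24InftyBounds` (for `Γ`, and for `(QΓQ*)⁻¹` through a
Schur-complement identity reducing it to a second finite-range coercive operator).

WHAT IS HERE.  `cDist`/`blkDist` (sup-distance of block labels; triangle inequality), `cBall`/`ball` with `card_cBall_le`
(`≤ (2r+1)²`), `card_ball_le` (`≤ L²(2r+1)²`); `trunc` (restriction to a finite set) with `ipS_trunc_le`; `HasRange` (finite range in
the block distance) with `comp`/`pow`/`apply_eq_apply_trunc`; the `𝓛²` algebra `ipS_sub_sub`, `ipS_add_add_le`,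
`norm_apply_sq_le_ipS`; the Richardson step `step M c = 1 − cM` with `ipS_step_le`, `ipS_step_pow_le`, `telescope`; the series bound
`sum_succ_mul_pow_le` (`(1−θ)²Σ_{k<K}(k+1)θ^k ≤ 1`); and the transfer theorem `norm_le_of_apply_eq` with the explicit constant
`supConst L σ Λ₂ ρ = 4L(2ρ+1)Λ₂/σ³`.
-/

namespace Literature.MathematicalPhysics.QuantumFieldTheory.DybalskiStottmeisterTanimoto2024.DST24FinitePropagation

open scoped RealInnerProductSpace BigOperators
open Literature.MathematicalPhysics.QuantumFieldTheory.DybalskiStottmeisterTanimoto2024.DST24Setting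
open Literature.MathematicalPhysics.QuantumFieldTheory.DybalskiStottmeisterTanimoto2024.DST24LinearConstraint
open Literature.MathematicalPhysics.QuantumFieldTheory.DybalskiStottmeisterTanimoto2024.DST24GreenFunction

noncomputable section

variable {L n₁ : ℕ}

/-! ## The block distance on `Ω` and the size of its balls -/

/-- Sup-distance of two coarse labels `y, y′ ∈ Ω₁`: `max_μ |y_μ − y′_μ|` (in label units). [cite: DybalskiStottmeisterTanimoto2024, §1.1 (Ω₁); §4.3 («`|y − y′|`»)] -/
def cDist (y y' : CSite n₁) : ℕ := Finset.univ.sup fun μ : Fin 2 => (y μ : ℕ).dist (y' μ)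

/-- [cite: DybalskiStottmeisterTanimoto2024, §4.3 («`|y − y′|`»)] -/
theorem dist_le_cDist (y y' : CSite n₁) (μ : Fin 2) : (y μ : ℕ).dist (y' μ) ≤ cDist y y' :=
  Finset.le_sup (f := fun μ : Fin 2 => (y μ : ℕ).dist (y' μ)) (Finset.mem_univ μ)

/-- [cite: DybalskiStottmeisterTanimoto2024, §4.3 («`|y − y′|`»)] -/
theorem cDist_le_iff {y y' : CSite n₁} {r : ℕ} : cDist y y' ≤ r ↔ ∀ μ, (y μ : ℕ).dist (y' μ) ≤ r := by
  simp [cDist, Finset.sup_le_iff]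

/-- [cite: DybalskiStottmeisterTanimoto2024, §4.3 («`|y − y′|`»)] -/
theorem cDist_self (y : CSite n₁) : cDist y y = 0 := by
  apply le_antisymm _ (Nat.zero_le _)
  exact cDist_le_iff.mpr fun μ => by rw [Nat.dist_self]

/-- [cite: DybalskiStottmeisterTanimoto2024, §4.3 («`|y − y′|`»)] -/
theorem cDist_comm (y y' : CSite n₁) : cDist y y' = cDist y' y := by
  unfold cDist
  exact Finset.sup_congr rfl fun μ _ => Nat.dist_comm _ _

/-- Triangle inequality for the label distance. [cite: DybalskiStottmeisterTanimoto2024, §4.3 («`|y − y′|`»)] -/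
theorem cDist_triangle (y y' y'' : CSite n₁) : cDist y y'' ≤ cDist y y' + cDist y' y'' :=
  cDist_le_iff.mpr fun μ => (Nat.dist.triangle_inequality _ _ _).trans
    (add_le_add (dist_le_cDist y y' μ) (dist_le_cDist y' y'' μ))

/-- The BLOCK DISTANCE of two sites of `Ω`: the sup-distance of the labels of their boxes `B(y_x)`, `B(y_{x′})`.
[cite: DybalskiStottmeisterTanimoto2024, §1.1 (y_x); §4.3 («`|x − x′|`»)] -/
def blkDist (x x' : Site L n₁) : ℕ := cDist (blk x) (blk x')

/-- [cite: DybalskiStottmeisterTanimoto2024, §1.1 (y_x)] -/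
theorem blkDist_eq (x x' : Site L n₁) : blkDist x x' = cDist (blk x) (blk x') := rfl

/-- [cite: DybalskiStottmeisterTanimoto2024, §1.1 (y_x)] -/
theorem blkDist_self (x : Site L n₁) : blkDist x x = 0 := cDist_self _

/-- [cite: DybalskiStottmeisterTanimoto2024, §1.1 (y_x)] -/
theorem blkDist_comm (x x' : Site L n₁) : blkDist x x' = blkDist x' x := cDist_comm _ _

/-- [cite: DybalskiStottmeisterTanimoto2024, §1.1 (y_x)] -/
theorem blkDist_triangle (x x' x'' : Site L n₁) : blkDist x x'' ≤ blkDist x x' + blkDist x' x'' := cDist_triangle _ _ _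

/-- Sites of one box are at block distance `0`. [cite: DybalskiStottmeisterTanimoto2024, §1.1 (B₁(y))] -/
theorem blkDist_eq_zero_of_blk_eq {x x' : Site L n₁} (h : blk x = blk x') : blkDist x x' = 0 := by
  rw [blkDist_eq, h, cDist_self]

/-- The ball of labels `{y′ : |y − y′|_∞ ≤ r}`. [cite: DybalskiStottmeisterTanimoto2024, §4.3 («`|y − y′|`»)] -/
def cBall (y : CSite n₁) (r : ℕ) : Finset (CSite n₁) := Finset.univ.filter fun y' => cDist y y' ≤ r

/-- [cite: DybalskiStottmeisterTanimoto2024, §4.3 («`|y − y′|`»)] -/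
theorem mem_cBall {y y' : CSite n₁} {r : ℕ} : y' ∈ cBall y r ↔ cDist y y' ≤ r := by simp [cBall]

/-- A label ball of radius `r` has at most `(2r+1)²` labels, whatever the volume. [cite: DybalskiStottmeisterTanimoto2024, §4.5 (norm-estimate) («`C` independent of `n`»)] -/
theorem card_cBall_le (y : CSite n₁) (r : ℕ) : (cBall y r).card ≤ (2 * r + 1) ^ 2 := by
  let φ : CSite n₁ → (Fin 2 → ℕ) := fun y' μ => (y' μ : ℕ) + r - (y μ : ℕ)
  have hmaps : ∀ y' ∈ cBall y r, φ y' ∈ Fintype.piFinset fun _ : Fin 2 => Finset.range (2 * r + 1) := by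
    intro y' hy'
    rw [Fintype.mem_piFinset]
    intro μ
    have h := (cDist_le_iff.mp (mem_cBall.mp hy')) μ
    rw [Finset.mem_range]
    change (y' μ : ℕ) + r - (y μ : ℕ) < 2 * r + 1
    unfold Nat.dist at h
    omega
  have hinj : Set.InjOn φ (cBall y r) := by
    intro y₁ h₁ y₂ h₂ h
    have h₁' := cDist_le_iff.mp (mem_cBall.mp (Finset.mem_coe.mp h₁))
    have h₂' := cDist_le_iff.mp (mem_cBall.mp (Finset.mem_coe.mp h₂))
    funext μ
    apply Fin.ext
    have e := congrFun h μ
    change (y₁ μ : ℕ) + r - (y μ : ℕ) = (y₂ μ : ℕ) + r - (y μ : ℕ) at e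
    have g₁ := h₁' μ
    have g₂ := h₂' μ
    unfold Nat.dist at g₁ g₂
    omega
  calc (cBall y r).card ≤ (Fintype.piFinset fun _ : Fin 2 => Finset.range (2 * r + 1)).card :=
        Finset.card_le_card_of_injOn φ hmaps hinj
    _ = (2 * r + 1) ^ 2 := by
        rw [Fintype.card_piFinset, Finset.prod_const, Finset.card_range, Finset.card_univ, Fintype.card_fin]

/-- The ball of sites `{x′ : blkDist(x,x′) ≤ r}`. [cite: DybalskiStottmeisterTanimoto2024, §4.3 («`|x − x′|`»)] -/
def ball (x : Site L n₁) (r : ℕ) : Finset (Site L n₁) := Finset.univ.filter fun x' => blkDist x x' ≤ r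

/-- [cite: DybalskiStottmeisterTanimoto2024, §4.3 («`|x − x′|`»)] -/
theorem mem_ball {x x' : Site L n₁} {r : ℕ} : x' ∈ ball x r ↔ blkDist x x' ≤ r := by simp [ball]

/-- [cite: DybalskiStottmeisterTanimoto2024, §4.3 («`|x − x′|`»)] -/
theorem mem_ball_self (x : Site L n₁) (r : ℕ) : x ∈ ball x r := mem_ball.mpr (by rw [blkDist_self]; exact Nat.zero_le _)

/-- A ball in the block distance is the union of the boxes of a label ball. [cite: DybalskiStottmeisterTanimoto2024, §1.1 (B₁(y))] -/
theorem ball_eq_biUnion (x : Site L n₁) (r : ℕ) : ball x r = (cBall (blk x) r).biUnion (box L) := by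
  ext x'
  rw [mem_ball, Finset.mem_biUnion]
  constructor
  · intro h
    exact ⟨blk x', mem_cBall.mpr h, mem_box_blk x'⟩
  · rintro ⟨y', hy', hx'⟩
    rw [blkDist_eq, mem_box.mp hx']
    exact mem_cBall.mp hy'

/-- **Volume-independence of the local counts**: a ball of block-radius `r` has at most `L²(2r+1)²` sites.
[cite: DybalskiStottmeisterTanimoto2024, §4.5 (norm-estimate) («`C` independent of `n`»)] -/
theorem card_ball_le (x : Site L n₁) (r : ℕ) : (ball x r).card ≤ L ^ 2 * (2 * r + 1) ^ 2 := by
  rw [ball_eq_biUnion]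
  calc ((cBall (blk x) r).biUnion (box L)).card ≤ ∑ y' ∈ cBall (blk x) r, (box L y').card := Finset.card_biUnion_le
    _ = (cBall (blk x) r).card * L ^ 2 := by simp_rw [card_box]; rw [Finset.sum_const, smul_eq_mul]
    _ ≤ (2 * r + 1) ^ 2 * L ^ 2 := Nat.mul_le_mul_right _ (card_cBall_le _ _)
    _ = L ^ 2 * (2 * r + 1) ^ 2 := Nat.mul_comm _ _

/-! ## `𝓛²(Ω; E)` algebra for `⟨·,·⟩_Ω` and truncation to a finite set -/

section Trunc

variable {E : Type*} [Zero E]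

/-- Restriction of `f` to a finite set of sites (zero outside). [cite: DybalskiStottmeisterTanimoto2024, §4.4 («`χ_{Ω^ℓ_1}`», restriction to a finite lattice)] -/
def trunc (S : Finset (Site L n₁)) (f : Site L n₁ → E) : Site L n₁ → E := fun x => if x ∈ S then f x else 0

/-- [cite: DybalskiStottmeisterTanimoto2024, §4.4 («`χ_{Ω^ℓ_1}`»)] -/
theorem trunc_apply_of_mem {S : Finset (Site L n₁)} (f : Site L n₁ → E) {x : Site L n₁} (hx : x ∈ S) : trunc S f x = f x := by
  rw [trunc, if_pos hx]

/-- [cite: DybalskiStottmeisterTanimoto2024, §4.4 («`χ_{Ω^ℓ_1}`»)] -/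
theorem trunc_apply_of_not_mem {S : Finset (Site L n₁)} (f : Site L n₁ → E) {x : Site L n₁} (hx : x ∉ S) :
    trunc S f x = 0 := by
  rw [trunc, if_neg hx]

end Trunc

section L2

variable {E : Type*} [NormedAddCommGroup E] [InnerProductSpace ℝ E]

/-- `⟨f,f⟩_Ω ≥ 0`. [cite: DybalskiStottmeisterTanimoto2024, Notation («`‖f‖_{2;Ω}`»)] -/
theorem ipS_self_nonneg (f : Site L n₁ → E) : 0 ≤ ipS f f := by
  rw [ipS_self]; exact Finset.sum_nonneg fun _ _ => sq_nonneg _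

/-- `‖f(x)‖² ≤ ⟨f,f⟩_Ω` — the (volume-free) passage from `𝓛²` to a point value. [cite: DybalskiStottmeisterTanimoto2024, Notation («`‖f‖_{2;Ω}`», «`‖f‖_{∞;Ω}`»)] -/
theorem norm_apply_sq_le_ipS (f : Site L n₁ → E) (x : Site L n₁) : ‖f x‖ ^ 2 ≤ ipS f f := by
  rw [ipS_self]
  exact Finset.single_le_sum (fun x _ => sq_nonneg (‖f x‖)) (Finset.mem_univ x)

/-- `‖f(x)‖ ≤ √⟨f,f⟩_Ω`. [cite: DybalskiStottmeisterTanimoto2024, Notation («`‖f‖_{2;Ω}`», «`‖f‖_{∞;Ω}`»)] -/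
theorem norm_apply_le_sqrt_ipS (f : Site L n₁ → E) (x : Site L n₁) : ‖f x‖ ≤ Real.sqrt (ipS f f) :=
  Real.le_sqrt_of_sq_le (norm_apply_sq_le_ipS f x)

/-- `⟨f, cg⟩ = c⟨f, g⟩`. [cite: DybalskiStottmeisterTanimoto2024, Notation] -/
theorem ipS_smul_right (c : ℝ) (f g : Site L n₁ → E) : ipS f (c • g) = c * ipS f g := by
  unfold ipS; simp only [Pi.smul_apply, inner_smul_right, Finset.mul_sum]

/-- `⟨cf, g⟩ = c⟨f, g⟩`. [cite: DybalskiStottmeisterTanimoto2024, Notation] -/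
theorem ipS_smul_left (c : ℝ) (f g : Site L n₁ → E) : ipS (c • f) g = c * ipS f g := by
  unfold ipS; simp only [Pi.smul_apply, real_inner_smul_left, Finset.mul_sum]

/-- `⟨f, g − g′⟩ = ⟨f, g⟩ − ⟨f, g′⟩`. [cite: DybalskiStottmeisterTanimoto2024, Notation] -/
theorem ipS_sub_right (f g g' : Site L n₁ → E) : ipS f (g - g') = ipS f g - ipS f g' := by
  unfold ipS; simp only [Pi.sub_apply, inner_sub_right, Finset.sum_sub_distrib]

/-- `⟨f − f′, g⟩ = ⟨f, g⟩ − ⟨f′, g⟩`. [cite: DybalskiStottmeisterTanimoto2024, Notation] -/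
theorem ipS_sub_left (f f' g : Site L n₁ → E) : ipS (f - f') g = ipS f g - ipS f' g := by
  unfold ipS; simp only [Pi.sub_apply, inner_sub_left, Finset.sum_sub_distrib]

/-- `⟨f + f′, g⟩ = ⟨f, g⟩ + ⟨f′, g⟩`. [cite: DybalskiStottmeisterTanimoto2024, Notation] -/
theorem ipS_add_left (f f' g : Site L n₁ → E) : ipS (f + f') g = ipS f g + ipS f' g := by
  unfold ipS; simp only [Pi.add_apply, inner_add_left, Finset.sum_add_distrib]

/-- `‖f − g‖² = ‖f‖² − 2⟨f,g⟩ + ‖g‖²` in `𝓛²(Ω)`. [cite: DybalskiStottmeisterTanimoto2024, Notation («`‖f‖_{2;Ω}`»)] -/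
theorem ipS_sub_sub (f g : Site L n₁ → E) : ipS (f - g) (f - g) = ipS f f - 2 * ipS f g + ipS g g := by
  rw [ipS_sub_left, ipS_sub_right, ipS_sub_right, ipS_comm g f]; ring

/-- `‖f + g‖² = ‖f‖² + 2⟨f,g⟩ + ‖g‖²` in `𝓛²(Ω)`. [cite: DybalskiStottmeisterTanimoto2024, Notation («`‖f‖_{2;Ω}`»)] -/
theorem ipS_add_add (f g : Site L n₁ → E) : ipS (f + g) (f + g) = ipS f f + 2 * ipS f g + ipS g g := by
  rw [ipS_add_left, ipS_comm f (f + g), ipS_comm g (f + g), ipS_add_left, ipS_add_left, ipS_comm g f]; ring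

/-- `‖f + g‖² ≤ 2‖f‖² + 2‖g‖²` in `𝓛²(Ω)`. [cite: DybalskiStottmeisterTanimoto2024, Notation («`‖f‖_{2;Ω}`»)] -/
theorem ipS_add_add_le (f g : Site L n₁ → E) : ipS (f + g) (f + g) ≤ 2 * ipS f f + 2 * ipS g g := by
  rw [ipS_add_add]
  have h := ipS_self_nonneg (f - g)
  rw [ipS_sub_sub] at h
  linarith

/-- `‖χ_S f‖²_{2;Ω} ≤ |S|·‖f‖²_{∞;Ω}` — the only place where a count of sites enters. [cite: DybalskiStottmeisterTanimoto2024, §4.5 (norm-estimate)] -/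
theorem ipS_trunc_le (S : Finset (Site L n₁)) (f : Site L n₁ → E) : ipS (trunc S f) (trunc S f) ≤ S.card * ‖f‖ ^ 2 := by
  rw [ipS_self]
  have e : ∀ x, ‖trunc S f x‖ ^ 2 = if x ∈ S then ‖f x‖ ^ 2 else 0 := by
    intro x
    by_cases hx : x ∈ S
    · rw [trunc_apply_of_mem f hx, if_pos hx]
    · rw [trunc_apply_of_not_mem f hx, if_neg hx, norm_zero]; ring
  simp_rw [e]
  rw [← Finset.sum_filter, Finset.filter_mem_eq_inter, Finset.univ_inter]
  calc ∑ x ∈ S, ‖f x‖ ^ 2 ≤ ∑ x ∈ S, ‖f‖ ^ 2 :=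
        Finset.sum_le_sum fun x _ => pow_le_pow_left₀ (norm_nonneg _) (norm_le_pi_norm f x) 2
    _ = S.card * ‖f‖ ^ 2 := by rw [Finset.sum_const, nsmul_eq_mul]

end L2

/-! ## Finite range in the block distance (finite propagation speed) -/

section Range

variable {E : Type*}

/-- `T` has RANGE `ρ`: `(Tf)(x)` depends only on `f` at the sites of block distance `≤ ρ` from `x`.
[cite: DybalskiStottmeisterTanimoto2024, §3.3 (derivative), (adjoint), §2.1 (2.5)–(2.6) (the finite-range building blocks `∂`, `∂*`, `Q`, `Q*`)] -/
def HasRange (T : (Site L n₁ → E) → (Site L n₁ → E)) (ρ : ℕ) : Prop :=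
  ∀ f g : Site L n₁ → E, ∀ x : Site L n₁, (∀ x', blkDist x x' ≤ ρ → f x' = g x') → T f x = T g x

/-- [cite: DybalskiStottmeisterTanimoto2024, §3.3] -/
theorem HasRange.mono {T : (Site L n₁ → E) → (Site L n₁ → E)} {ρ ρ' : ℕ} (h : HasRange T ρ) (hρ : ρ ≤ ρ') :
    HasRange T ρ' :=
  fun f g x hfg => h f g x fun x' hx' => hfg x' (hx'.trans hρ)

/-- The identity has range `0`. [cite: DybalskiStottmeisterTanimoto2024, §3.3] -/
theorem hasRange_id : HasRange (id : (Site L n₁ → E) → (Site L n₁ → E)) 0 :=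
  fun f g x hfg => hfg x (by rw [blkDist_self])

/-- Ranges add under composition. [cite: DybalskiStottmeisterTanimoto2024, §3.3] -/
theorem HasRange.comp {T S : (Site L n₁ → E) → (Site L n₁ → E)} {ρ τ : ℕ} (hT : HasRange T ρ) (hS : HasRange S τ) :
    HasRange (T ∘ S) (ρ + τ) := by
  intro f g x hfg
  change T (S f) x = T (S g) x
  refine hT _ _ x fun x' hx' => hS _ _ x' fun x'' hx'' => hfg x'' ?_
  exact (blkDist_triangle x x' x'').trans (add_le_add hx' hx'')

/-- **Finite propagation speed**: the `k`-th iterate of a range-`ρ` map has range `kρ`. [cite: DybalskiStottmeisterTanimoto2024, §4.3 («paths» of the random walk expansion — here replaced by iteration)] -/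
theorem HasRange.iterate {T : (Site L n₁ → E) → (Site L n₁ → E)} {ρ : ℕ} (hT : HasRange T ρ) :
    ∀ k : ℕ, HasRange T^[k] (k * ρ) := by
  intro k
  induction k with
  | zero => simpa using (hasRange_id (L := L) (n₁ := n₁) (E := E))
  | succ k ih =>
    rw [Function.iterate_succ']
    have h := hT.comp ih
    refine h.mono (by rw [Nat.succ_mul]; omega)

end Range

section RangeLinear

variable {E : Type*} [AddCommGroup E] [Module ℝ E]

omit [Module ℝ E] in
/-- [cite: DybalskiStottmeisterTanimoto2024, §3.3] -/
theorem HasRange.sub {T S : (Site L n₁ → E) → (Site L n₁ → E)} {ρ : ℕ} (hT : HasRange T ρ) (hS : HasRange S ρ) :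
    HasRange (fun f => T f - S f) ρ :=
  fun f g x hfg => by
    show (T f - S f) x = (T g - S g) x
    rw [Pi.sub_apply, Pi.sub_apply, hT f g x hfg, hS f g x hfg]

omit [Module ℝ E] in
/-- [cite: DybalskiStottmeisterTanimoto2024, §3.3] -/
theorem HasRange.add {T S : (Site L n₁ → E) → (Site L n₁ → E)} {ρ : ℕ} (hT : HasRange T ρ) (hS : HasRange S ρ) :
    HasRange (fun f => T f + S f) ρ :=
  fun f g x hfg => by
    show (T f + S f) x = (T g + S g) x
    rw [Pi.add_apply, Pi.add_apply, hT f g x hfg, hS f g x hfg]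

/-- [cite: DybalskiStottmeisterTanimoto2024, §3.3] -/
theorem HasRange.smul {T : (Site L n₁ → E) → (Site L n₁ → E)} {ρ : ℕ} (hT : HasRange T ρ) (c : ℝ) :
    HasRange (fun f => c • T f) ρ :=
  fun f g x hfg => by
    show (c • T f) x = (c • T g) x
    rw [Pi.smul_apply, Pi.smul_apply, hT f g x hfg]

/-- A linear endomorphism's power has range `kρ`. [cite: DybalskiStottmeisterTanimoto2024, §4.3] -/
theorem HasRange.pow {T : (Site L n₁ → E) →ₗ[ℝ] (Site L n₁ → E)} {ρ : ℕ} (hT : HasRange T ρ) (k : ℕ) :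
    HasRange (⇑(T ^ k)) (k * ρ) := by
  intro f g x hfg
  rw [Module.End.pow_apply, Module.End.pow_apply]
  exact hT.iterate k f g x hfg

end RangeLinear

section RangeTrunc

variable {E : Type*} [Zero E]

/-- A range-`ρ` map evaluated at `x` sees only `f` on the ball `B(x, ρ)`: `(Tf)(x) = (T(χ_{B(x,ρ)}f))(x)`.
[cite: DybalskiStottmeisterTanimoto2024, §4.4 (restriction to a finite lattice)] -/
theorem HasRange.apply_eq_apply_trunc {T : (Site L n₁ → E) → (Site L n₁ → E)} {ρ : ℕ} (hT : HasRange T ρ)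
    (f : Site L n₁ → E) (x : Site L n₁) : T f x = T (trunc (ball x ρ) f) x :=
  hT _ _ x fun _ hx' => (trunc_apply_of_mem f (mem_ball.mpr hx')).symm

end RangeTrunc

/-! ## The Richardson step `T = 1 − cM`: `𝓛²` contraction and the exact telescoping identity -/

section Step

variable {E : Type*} [NormedAddCommGroup E] [InnerProductSpace ℝ E]

/-- `T := 1 − cM`. [cite: DybalskiStottmeisterTanimoto2024, §4.4 proof of Lemma (Q-G-R-Q-lemma) («Neumann series»)] -/
def step (M : (Site L n₁ → E) →ₗ[ℝ] (Site L n₁ → E)) (c : ℝ) : (Site L n₁ → E) →ₗ[ℝ] (Site L n₁ → E) :=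
  LinearMap.id - c • M

/-- [cite: DybalskiStottmeisterTanimoto2024, §4.4 («Neumann series»)] -/
theorem step_apply (M : (Site L n₁ → E) →ₗ[ℝ] (Site L n₁ → E)) (c : ℝ) (f : Site L n₁ → E) :
    step M c f = f - c • M f := rfl

/-- `T = 1 − cM` has the range of `M`. [cite: DybalskiStottmeisterTanimoto2024, §4.4 («Neumann series»)] -/
theorem hasRange_step {M : (Site L n₁ → E) →ₗ[ℝ] (Site L n₁ → E)} {ρ : ℕ} (hM : HasRange M ρ) (c : ℝ) :
    HasRange (step M c) ρ := by
  have h := (hasRange_id (L := L) (n₁ := n₁) (E := E)).mono (Nat.zero_le ρ)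
  exact h.sub (hM.smul c)

/-- **`𝓛²` contraction of the Richardson step.**  If `σ⟨g,g⟩ ≤ ⟨g,Mg⟩` and `⟨Mg,Mg⟩ ≤ Λ₂⟨g,g⟩` then, with `c = σ/Λ₂`,
`⟨Tg,Tg⟩ ≤ (1 − σ²/Λ₂)⟨g,g⟩` (expand `‖g − cMg‖²`; no symmetry of `M` is used).
[cite: DybalskiStottmeisterTanimoto2024, §4.2 Lemma (inverse-lemma) 2. (many-boxes), (bounded-Laplacian); §4.4 («Neumann series»)] -/
theorem ipS_step_le {M : (Site L n₁ → E) →ₗ[ℝ] (Site L n₁ → E)} {σ Λ2 : ℝ} (hσ : 0 ≤ σ) (hΛ : 0 < Λ2)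
    (hcoer : ∀ g, σ * ipS g g ≤ ipS g (M g)) (hbdd : ∀ g, ipS (M g) (M g) ≤ Λ2 * ipS g g) (g : Site L n₁ → E) :
    ipS (step M (σ / Λ2) g) (step M (σ / Λ2) g) ≤ (1 - σ ^ 2 / Λ2) * ipS g g := by
  rw [step_apply, ipS_sub_sub, ipS_smul_right, ipS_smul_left, ipS_smul_right]
  have h1 := hcoer g
  have h2 := hbdd g
  have hc : 0 ≤ σ / Λ2 * (σ / Λ2) := mul_self_nonneg _
  have h3 : σ / Λ2 * (σ / Λ2 * ipS (M g) (M g)) ≤ σ / Λ2 * (σ / Λ2) * (Λ2 * ipS g g) := by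
    rw [← mul_assoc]; exact mul_le_mul_of_nonneg_left h2 hc
  have h4 : σ / Λ2 * (σ / Λ2) * (Λ2 * ipS g g) = σ ^ 2 / Λ2 * ipS g g := by
    field_simp
  have h5 : σ / Λ2 * (σ * ipS g g) ≤ σ / Λ2 * ipS g (M g) := mul_le_mul_of_nonneg_left h1 (div_nonneg hσ hΛ.le)
  have h6 : σ / Λ2 * (σ * ipS g g) = σ ^ 2 / Λ2 * ipS g g := by ring
  nlinarith

/-- Iterating: `⟨T^kg, T^kg⟩ ≤ θ₂^k⟨g,g⟩`, `θ₂ = 1 − σ²/Λ₂`. [cite: DybalskiStottmeisterTanimoto2024, §4.4 («Neumann series»)] -/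
theorem ipS_step_pow_le {M : (Site L n₁ → E) →ₗ[ℝ] (Site L n₁ → E)} {σ Λ2 : ℝ} (hσ : 0 ≤ σ) (hΛ : 0 < Λ2)
    (hσΛ : σ ^ 2 ≤ Λ2) (hcoer : ∀ g, σ * ipS g g ≤ ipS g (M g)) (hbdd : ∀ g, ipS (M g) (M g) ≤ Λ2 * ipS g g) :
    ∀ (k : ℕ) (g : Site L n₁ → E),
      ipS ((step M (σ / Λ2) ^ k) g) ((step M (σ / Λ2) ^ k) g) ≤ (1 - σ ^ 2 / Λ2) ^ k * ipS g g := by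
  have hθ : 0 ≤ 1 - σ ^ 2 / Λ2 := by
    rw [sub_nonneg, div_le_one hΛ]; exact hσΛ
  intro k
  induction k with
  | zero => intro g; simp
  | succ k ih =>
    intro g
    rw [pow_succ, Module.End.mul_apply, pow_succ]
    calc ipS ((step M (σ / Λ2) ^ k) (step M (σ / Λ2) g)) ((step M (σ / Λ2) ^ k) (step M (σ / Λ2) g))
        ≤ (1 - σ ^ 2 / Λ2) ^ k * ipS (step M (σ / Λ2) g) (step M (σ / Λ2) g) := ih _
      _ ≤ (1 - σ ^ 2 / Λ2) ^ k * ((1 - σ ^ 2 / Λ2) * ipS g g) :=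
          mul_le_mul_of_nonneg_left (ipS_step_le hσ hΛ hcoer hbdd g) (pow_nonneg hθ k)
      _ = (1 - σ ^ 2 / Λ2) ^ k * (1 - σ ^ 2 / Λ2) * ipS g g := by ring

/-- **The exact telescoping identity**: if `Mu = f` then `u = Σ_{k<K} c·T^kf + T^Ku` for every `K` (from `u − Tu = cMu = cf`).
[cite: DybalskiStottmeisterTanimoto2024, §4.4 («we can sum up … the Neumann series»)] -/
theorem telescope {M : (Site L n₁ → E) →ₗ[ℝ] (Site L n₁ → E)} (c : ℝ) {u f : Site L n₁ → E} (hu : M u = f) :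
    ∀ K : ℕ, u = (∑ k ∈ Finset.range K, c • (step M c ^ k) f) + (step M c ^ K) u := by
  have h0 : u = c • f + step M c u := by
    rw [step_apply, hu]; abel
  intro K
  induction K with
  | zero => simp
  | succ K ih =>
    rw [Finset.sum_range_succ, pow_succ, Module.End.mul_apply]
    conv_lhs => rw [ih]
    conv_lhs => rw [h0]
    rw [map_add, map_smul]
    abel

end Step

/-! ## The series `Σ (k+1)θ^k` and the transfer theorem -/

/-- `(1 − θ)²·Σ_{k<K} (k+1)θ^k = 1 − (K+1)θ^K + Kθ^{K+1}`. [cite: DybalskiStottmeisterTanimoto2024, §4.4 («Neumann series»)] -/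
theorem sum_succ_mul_pow_eq (θ : ℝ) (K : ℕ) :
    (1 - θ) ^ 2 * ∑ k ∈ Finset.range K, ((k : ℝ) + 1) * θ ^ k = 1 - ((K : ℝ) + 1) * θ ^ K + K * θ ^ (K + 1) := by
  induction K with
  | zero => simp
  | succ K ih =>
    rw [Finset.sum_range_succ, mul_add, ih]
    push_cast
    ring

/-- `(1 − θ)²·Σ_{k<K} (k+1)θ^k ≤ 1` for `0 ≤ θ ≤ 1`. [cite: DybalskiStottmeisterTanimoto2024, §4.4 («Neumann series»)] -/
theorem sum_succ_mul_pow_le {θ : ℝ} (h0 : 0 ≤ θ) (h1 : θ ≤ 1) (K : ℕ) :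
    (1 - θ) ^ 2 * ∑ k ∈ Finset.range K, ((k : ℝ) + 1) * θ ^ k ≤ 1 := by
  rw [sum_succ_mul_pow_eq]
  have hK : (0 : ℝ) ≤ K := Nat.cast_nonneg K
  have hθK : 0 ≤ θ ^ K := pow_nonneg h0 K
  have : (K : ℝ) * θ ^ (K + 1) ≤ ((K : ℝ) + 1) * θ ^ K := by
    rw [pow_succ]
    nlinarith [mul_nonneg hK hθK]
  linarith

/-- `Σ_{k<K} (k+1)θ^k ≤ 1/(1−θ)²` for `0 ≤ θ < 1`. [cite: DybalskiStottmeisterTanimoto2024, §4.4 («Neumann series»)] -/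
theorem sum_succ_mul_pow_le' {θ : ℝ} (h0 : 0 ≤ θ) (h1 : θ < 1) (K : ℕ) :
    ∑ k ∈ Finset.range K, ((k : ℝ) + 1) * θ ^ k ≤ 1 / (1 - θ) ^ 2 := by
  have hpos : 0 < (1 - θ) ^ 2 := pow_pos (by linarith) 2
  rw [le_div_iff₀ hpos, mul_comm]
  exact sum_succ_mul_pow_le h0 h1.le K

section Transfer

variable {E : Type*} [NormedAddCommGroup E] [InnerProductSpace ℝ E]

/-- The explicit constant of the transfer theorem: `C(L, σ, Λ₂, ρ) = 4L(2ρ+1)Λ₂/σ³` (independent of the volume `n₁`).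
[cite: DybalskiStottmeisterTanimoto2024, §4.5 Lemma (infty-bounds) («for `C` independent of `n`»)] -/
def supConst (L : ℕ) (σ Λ2 : ℝ) (ρ : ℕ) : ℝ := 4 * L * (2 * ρ + 1) * Λ2 / σ ^ 3

/-- [cite: DybalskiStottmeisterTanimoto2024, §4.5 Lemma (infty-bounds)] -/
theorem supConst_nonneg (L : ℕ) {σ Λ2 : ℝ} (hσ : 0 ≤ σ) (hΛ : 0 ≤ Λ2) (ρ : ℕ) : 0 ≤ supConst L σ Λ2 ρ := by
  unfold supConst; positivity

/-- One term of the series: `‖(T^kf)(x)‖ ≤ θ₂^{k/2}·L(2kρ+1)·‖f‖_{∞;Ω}` — finite propagation (`T^kf` at `x` sees `f` on `B(x,kρ)` only),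
the `𝓛²` contraction, and the site count `|B(x,kρ)| ≤ L²(2kρ+1)²`.
[cite: DybalskiStottmeisterTanimoto2024, §4.5 (norm-estimate); §4.3–4.4 (decay ⇒ volume-uniform row sums)] -/
theorem norm_step_pow_apply_le {M : (Site L n₁ → E) →ₗ[ℝ] (Site L n₁ → E)} {σ Λ2 : ℝ} {ρ : ℕ} (hσ : 0 ≤ σ)
    (hΛ : 0 < Λ2) (hσΛ : σ ^ 2 ≤ Λ2) (hcoer : ∀ g, σ * ipS g g ≤ ipS g (M g))
    (hbdd : ∀ g, ipS (M g) (M g) ≤ Λ2 * ipS g g) (hM : HasRange M ρ) (k : ℕ) (f : Site L n₁ → E) (x : Site L n₁) :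
    ‖(step M (σ / Λ2) ^ k) f x‖ ≤ Real.sqrt (1 - σ ^ 2 / Λ2) ^ k * (L * (2 * (k * ρ) + 1)) * ‖f‖ := by
  set θ2 : ℝ := 1 - σ ^ 2 / Λ2 with hθ2
  have hθ : 0 ≤ θ2 := by rw [hθ2, sub_nonneg, div_le_one hΛ]; exact hσΛ
  have hrange := (hasRange_step hM (σ / Λ2)).pow k
  set g := trunc (ball x (k * ρ)) f with hg
  rw [hrange.apply_eq_apply_trunc f x, ← hg]
  have h1 : ‖(step M (σ / Λ2) ^ k) g x‖ ^ 2 ≤ θ2 ^ k * ((L : ℝ) ^ 2 * (2 * (k * ρ) + 1) ^ 2 * ‖f‖ ^ 2) :=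
    calc ‖(step M (σ / Λ2) ^ k) g x‖ ^ 2 ≤ ipS ((step M (σ / Λ2) ^ k) g) ((step M (σ / Λ2) ^ k) g) :=
          norm_apply_sq_le_ipS _ x
      _ ≤ θ2 ^ k * ipS g g := ipS_step_pow_le hσ hΛ hσΛ hcoer hbdd k g
      _ ≤ θ2 ^ k * ((ball x (k * ρ)).card * ‖f‖ ^ 2) := mul_le_mul_of_nonneg_left (ipS_trunc_le _ f) (pow_nonneg hθ k)
      _ ≤ θ2 ^ k * ((L : ℝ) ^ 2 * (2 * (k * ρ) + 1) ^ 2 * ‖f‖ ^ 2) := by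
          refine mul_le_mul_of_nonneg_left (mul_le_mul_of_nonneg_right ?_ (sq_nonneg _)) (pow_nonneg hθ k)
          exact_mod_cast card_ball_le x (k * ρ)
  have h2 : θ2 ^ k * ((L : ℝ) ^ 2 * (2 * (k * ρ) + 1) ^ 2 * ‖f‖ ^ 2) =
      (Real.sqrt θ2 ^ k * (L * (2 * (k * ρ) + 1)) * ‖f‖) ^ 2 := by
    rw [mul_pow, mul_pow, ← pow_mul, mul_comm k 2, pow_mul, Real.sq_sqrt hθ]; ring
  rw [h2] at h1
  have hnn : 0 ≤ Real.sqrt θ2 ^ k * (L * (2 * (k * ρ) + 1)) * ‖f‖ := by positivity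
  exact (abs_le_of_sq_le_sq' h1 hnn).2.trans (le_of_eq (by rw [hθ2]))

/-- **Transfer theorem (`𝓛²`-coercive + finite range ⇒ volume-uniform `𝓛^∞` bound).**  Let `M` be linear on `𝓛²(Ω; E)` with
`σ⟨g,g⟩ ≤ ⟨g,Mg⟩`, `⟨Mg,Mg⟩ ≤ Λ₂⟨g,g⟩` (`0 < σ`, `σ² ≤ Λ₂`) and range `ρ` in the block distance.  Then every solution of `Mu = f`
satisfies `‖u‖_{∞;Ω} ≤ (4L(2ρ+1)Λ₂/σ³)‖f‖_{∞;Ω}` — a constant independent of `n₁`.  This is the tree's replacement for the row-sum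
estimate (norm-estimate) fed with the kernel decay of §§4.3–4.4.
[cite: DybalskiStottmeisterTanimoto2024, §4.5 (norm-estimate) and Lemma (infty-bounds) («for `C` independent of `n`»)] -/
theorem norm_le_of_apply_eq {M : (Site L n₁ → E) →ₗ[ℝ] (Site L n₁ → E)} {σ Λ2 : ℝ} {ρ : ℕ} (hσ : 0 < σ) (hσΛ : σ ^ 2 ≤ Λ2)
    (hcoer : ∀ g, σ * ipS g g ≤ ipS g (M g)) (hbdd : ∀ g, ipS (M g) (M g) ≤ Λ2 * ipS g g) (hM : HasRange M ρ)
    {u f : Site L n₁ → E} (hu : M u = f) : ‖u‖ ≤ supConst L σ Λ2 ρ * ‖f‖ := by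
  have hΛ : 0 < Λ2 := lt_of_lt_of_le (pow_pos hσ 2) hσΛ
  set c : ℝ := σ / Λ2 with hc
  set θ2 : ℝ := 1 - σ ^ 2 / Λ2 with hθ2
  set θ : ℝ := Real.sqrt θ2 with hθ
  have hθ2nn : 0 ≤ θ2 := by rw [hθ2, sub_nonneg, div_le_one hΛ]; exact hσΛ
  have hθ2lt : θ2 < 1 := by
    rw [hθ2, sub_lt_self_iff]; positivity
  have hθnn : 0 ≤ θ := Real.sqrt_nonneg _
  have hθlt : θ < 1 := by rw [hθ, Real.sqrt_lt' one_pos, one_pow]; exact hθ2lt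
  have hθsq : θ ^ 2 = θ2 := Real.sq_sqrt hθ2nn
  -- `1 − θ ≥ (1 − θ²)/2 = σ²/(2Λ₂)`
  have h1θ : σ ^ 2 / (2 * Λ2) ≤ 1 - θ := by
    have : (1 - θ) * (1 + θ) = σ ^ 2 / Λ2 := by
      have e : (1 - θ) * (1 + θ) = 1 - θ ^ 2 := by ring
      rw [e, hθsq, hθ2]; ring
    have h2 : 1 + θ ≤ 2 := by linarith
    rw [div_le_iff₀ (by positivity)]
    calc σ ^ 2 = (1 - θ) * (1 + θ) * Λ2 := by rw [this]; field_simp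
      _ ≤ (1 - θ) * 2 * Λ2 := by gcongr
      _ = (1 - θ) * (2 * Λ2) := by ring
  have hc0 : 0 ≤ c := div_nonneg hσ.le hΛ.le
  -- the bound on the partial sums
  set B : ℝ := supConst L σ Λ2 ρ * ‖f‖ with hB
  have hpartial : ∀ K : ℕ, ∑ k ∈ Finset.range K, ‖c • (step M c ^ k) f‖ ≤ B := by
    intro K
    have hterm : ∀ k ∈ Finset.range K, ‖c • (step M c ^ k) f‖ ≤ c * (L * (2 * ρ + 1)) * ‖f‖ * (((k : ℝ) + 1) * θ ^ k) := by
      intro k _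
      refine (pi_norm_le_iff_of_nonneg (by positivity)).mpr fun x => ?_
      rw [Pi.smul_apply, norm_smul, Real.norm_of_nonneg hc0]
      have h := norm_step_pow_apply_le hσ.le hΛ hσΛ hcoer hbdd hM k f x
      rw [← hc, ← hθ2, ← hθ] at h
      have hk : (L : ℝ) * (2 * (k * ρ) + 1) ≤ L * (2 * ρ + 1) * ((k : ℝ) + 1) := by
        have : (2 * ((k : ℝ) * ρ) + 1) ≤ (2 * ρ + 1) * ((k : ℝ) + 1) := by
          nlinarith [Nat.cast_nonneg (α := ℝ) k, Nat.cast_nonneg (α := ℝ) ρ]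
        calc (L : ℝ) * (2 * (k * ρ) + 1) ≤ L * ((2 * ρ + 1) * ((k : ℝ) + 1)) :=
              mul_le_mul_of_nonneg_left this (Nat.cast_nonneg L)
          _ = L * (2 * ρ + 1) * ((k : ℝ) + 1) := by ring
      calc c * ‖(step M c ^ k) f x‖ ≤ c * (θ ^ k * (L * (2 * (k * ρ) + 1)) * ‖f‖) := mul_le_mul_of_nonneg_left h hc0
        _ ≤ c * (θ ^ k * (L * (2 * ρ + 1) * ((k : ℝ) + 1)) * ‖f‖) := by gcongr
        _ = c * (L * (2 * ρ + 1)) * ‖f‖ * (((k : ℝ) + 1) * θ ^ k) := by ring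
    calc ∑ k ∈ Finset.range K, ‖c • (step M c ^ k) f‖
        ≤ ∑ k ∈ Finset.range K, c * (L * (2 * ρ + 1)) * ‖f‖ * (((k : ℝ) + 1) * θ ^ k) := Finset.sum_le_sum hterm
      _ = c * (L * (2 * ρ + 1)) * ‖f‖ * ∑ k ∈ Finset.range K, ((k : ℝ) + 1) * θ ^ k := by rw [Finset.mul_sum]
      _ ≤ c * (L * (2 * ρ + 1)) * ‖f‖ * (1 / (1 - θ) ^ 2) :=
          mul_le_mul_of_nonneg_left (sum_succ_mul_pow_le' hθnn hθlt K) (by positivity)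
      _ ≤ c * (L * (2 * ρ + 1)) * ‖f‖ * (1 / (σ ^ 2 / (2 * Λ2)) ^ 2) := by
          gcongr
      _ = B := by
          rw [hB, hc, supConst]
          field_simp
          ring
  -- the tail `‖T^K u‖_∞ ≤ θ^K √⟨u,u⟩`
  have htail : ∀ K : ℕ, ‖(step M c ^ K) u‖ ≤ θ ^ K * Real.sqrt (ipS u u) := by
    intro K
    refine (pi_norm_le_iff_of_nonneg (by positivity)).mpr fun x => ?_
    have h1 : ‖(step M c ^ K) u x‖ ^ 2 ≤ (θ ^ K * Real.sqrt (ipS u u)) ^ 2 :=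
      calc ‖(step M c ^ K) u x‖ ^ 2 ≤ ipS ((step M c ^ K) u) ((step M c ^ K) u) := norm_apply_sq_le_ipS _ x
        _ ≤ θ2 ^ K * ipS u u := ipS_step_pow_le hσ.le hΛ hσΛ hcoer hbdd K u
        _ = (θ ^ K * Real.sqrt (ipS u u)) ^ 2 := by
            rw [mul_pow, ← pow_mul, mul_comm K 2, pow_mul, hθsq, Real.sq_sqrt (ipS_self_nonneg u)]
    exact (abs_le_of_sq_le_sq' h1 (by positivity)).2
  -- `‖u‖ ≤ B + θ^K √⟨u,u⟩` for every `K`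
  have hK : ∀ K : ℕ, ‖u‖ ≤ B + θ ^ K * Real.sqrt (ipS u u) := by
    intro K
    calc ‖u‖ = ‖(∑ k ∈ Finset.range K, c • (step M c ^ k) f) + (step M c ^ K) u‖ := by rw [← telescope c hu K]
      _ ≤ ‖∑ k ∈ Finset.range K, c • (step M c ^ k) f‖ + ‖(step M c ^ K) u‖ := norm_add_le _ _
      _ ≤ (∑ k ∈ Finset.range K, ‖c • (step M c ^ k) f‖) + ‖(step M c ^ K) u‖ := by
          gcongr; exact norm_sum_le _ _
      _ ≤ B + θ ^ K * Real.sqrt (ipS u u) := add_le_add (hpartial K) (htail K)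
  -- let `K → ∞`
  by_contra hlt
  rw [not_le] at hlt
  set D := Real.sqrt (ipS u u) with hD
  have hD0 : 0 ≤ D := Real.sqrt_nonneg _
  rcases hD0.eq_or_lt with hD00 | hDpos
  · have := hK 0
    rw [← hD00, mul_zero, add_zero] at this
    exact absurd this (not_le.mpr hlt)
  · obtain ⟨K, hKε⟩ := exists_pow_lt_of_lt_one (div_pos (sub_pos.mpr hlt) hDpos) hθlt
    have h := hK K
    have : θ ^ K * D < ‖u‖ - B := by rwa [lt_div_iff₀ hDpos] at hKε
    linarith

end Transfer

end

end Literature.MathematicalPhysics.QuantumFieldTheory.DybalskiStottmeisterTanimoto2024.DST24FinitePropagation
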